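/-
Copyright (c) 2026 the pub-hodgecm-mathlib formalisation cell (harness21).  Prover seat hodgecm-mathlib-A-p06 (g29) — (U) road, U4-DISCHARGE (W2)-(n2) «the top-form disc constant» (owner A-p19 (g24)
MEMO-U4-NC-v1 §1 (n2); LEAD F0P3a-plan (g10) T9-40∕T9-41).
-/
import Literature.NumberTheory.Weil1964.UnitaryArchLocalTopFormHaarChartMeasure   -- FILE 4 (A-p06 g29): `lintegral_archLocalTopFormHaar_eq_setLIntegral` (+ FILES 1–3, ★ U1 A∕B∕C)
import Literature.NumberTheory.Weil1964.UnitaryArchLocalCayleyWeightDet           -- ★ p844641 (A-p12 g20) (b3)-(i): `cayleyWeightC_eq`, `det_one_sub_eq_conj_det_one_add`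
import Literature.NumberTheory.Weil1964.UnitaryArchLocalTraceFormNondegenerate     -- ★ p844433 (A-p19 g24) U1′: `lieGramDetC_ne_zero_of_conjTranspose_eq`, `isHaarMeasure_localTopFormHaar_of_conjTranspose_eq`
import Literature.NumberTheory.Automorphic.ArchRankOneOrbitMeasure                -- ★ HAT-BOX (F0P3a-p07 g7): `exists_map_chart_eq_smul_discHyperbolicMeasure`, `chart_eq_div`, `continuous_chart`
import Mathlib.MeasureTheory.Measure.Lebesgue.VolumeOfBalls
import HarnessLib

/-!
# The top-form disc constant: `π · C_disc(μ^TF on U(1,1)) = ∫_{𝔲(2)} w₀ dλ = vol^TF(U(2))` — BY A CHANGE OF VARIABLES, no tube, no Jacobian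
# ((U) road, U4-DISCHARGE (W2)-(n2); Helgason 2000 Introduction §4 + Ch. I §1 Thm. 1.14; Rogawski 1990 §1.7, §8.2 p. 118)

Topic `NumberTheory/Weil1964`, namespace `Literature.NumberTheory.Weil1964.UnitaryArchLocalTopForm`.  THEOREMS ONLY (no definition, no instance, no notation, no named fact,
no `sorry`).  Cell `pub/hodgecm-mathlib`, crux H413 = `stmt-HodgeConjecture-24833` (supports only).  Owner's memo `MEMO-U4-NC-v1` (A-p19 (g24)) §1: (W2) ⟺ `c_fib = 1` ∧
`π · C_disc(localTopFormHaar 2 J₋) = V₂`; THIS FILE proves the second conjunct with `V₂` in the junction's currency «window-free Lie-algebra integral of `𝔲(2)`»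
(★ `blockMass_two_of_massEqSource`), for EVERY `C` with `(μ^TF_{J₋}).map π = C • μ_hyp` (★ HAT-BOX gives one, `exists_topFormDiscConstant` repackages it).
HONEST LABEL: HC_CM is proved only modulo the 2 remaining named inputs (hLiu418 24832, h413 24833) until rung 0 closes; U4 is an in-house normalisation statement and
this file is one brick of its discharge — nothing printed is discharged here.

THE ARGUMENT (`J₋ = diag(1, −1)`, `G₋ = U(J₋)(ℂ) = U(1,1)`, `π h = h₁₀ ∕ h₀₀ ∈ 𝔻`, `μ_hyp = (1 − |w|²)⁻² dA|_𝔻`, `F(w) = (1 − |w|²)²`).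
* §1 THE TWIST (any `N`, any hermitian involution `Jw`): `X ↦ Jw·X` is an `ℝ`-linear isomorphism `𝔲(Jw) ≃ 𝔲(1_N)` (`Xᴴ Jw + Jw X = 0 ⟺ (Jw X)ᴴ + Jw X = 0`) carrying the
  trace-form Lebesgue measure of `𝔲(Jw)` to that of `𝔲(1_N)` (`exists_formMul_equiv_map_lieStdLebesgueC`): the Gram matrix of the mapped basis is `Θᵀ · Gram`, `Θ` the matrix of
  the involution `X ↦ Jw X Jw` of `𝔲(Jw)`, `|det Θ| = 1`.
* §2 `N = 2`: the polynomial identity `((1 − X) · adj(1 + X))₀₀ = det(1 − J₋ X)` (all `X ∈ M₂(ℂ)`), hence on the chart source `ĉ(X)₀₀ = det(1 − J₋X) ∕ det(1 + X)` and, with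
  `|h₀₀|² − |h₁₀|² = 1` on `G₋` (★ H1) and ★ `cayleyWeightC_eq` (`w₀ = |det(1 + ·)|⁻⁴` on `𝔲(J₋)` AND on `𝔲(2)`) + ★ `det_one_sub_eq_conj_det_one_add`:
  **`F(π(ĉ X)) · w₀^{J₋}(X) = w₀^{1}(J₋ X)`** (`sq_one_sub_norm_sq_chart_mul_cayleyWeightC_eq`).
* §3 `∫_{G₋} F(π h) dμ(h)`, for ANY measure `μ` on `G₋` read in the Cayley chart (`hμ`: `∫⁻ g dμ = ∫⁻_{source} g(ĉX) w₀(X) dλ_{J₋}` — ★ FILE 4 for `μ^TF`), equals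
  `∫⁻_{𝔲(2)} w₀ dλ_{1}` (§1 + §2 + `λ(sourceᶜ) = 0` ★ FILE 1); and for ANY `C` with `μ.map π = C • μ_hyp` it equals `C · ∫_𝔻 F dμ_hyp = C · vol(𝔻) = C · π`.  Hence the HEAD
  **`topFormDiscConstant_mul_pi_eq_lintegral`**: `(C : ℝ≥0∞) · π = ∫⁻_{𝔲(2)} w₀ dλ` for `μ = localTopFormHaar 2 J₋` (read at a complex place of a CM field through ★ FILE 4), the
  `cayleySourceC` ∕ `diagonal (fun _ => 1)` spellings of the junction, and the existence package over ★ HAT-BOX.  With ★ A-p12 (g20) (b3)-(iii) `V₂ = π³∕2` this is the owner's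
  paper value `C_disc^TF = π²∕2` (not needed for (W2), not restated here).

## References
* S. Helgason, *Groups and Geometric Analysis*, AMS Math. Surveys Monogr. 83 (2000), Introduction §4 Thm. 4.2 (`SU(1,1)∕T ≅ 𝔻`, `(1 − |z|²)⁻² dz`); Ch. I §1 Thm. 1.14 p. 96. [Helgason2000]
* J. D. Rogawski, *Automorphic Representations of Unitary Groups in Three Variables*, Ann. of Math. Stud. 123 (1990), §1.7 p. 6, §8.2 p. 118 (compatible measures). [Rogawski1990]
* H. Weyl, *The Classical Groups, their Invariants and Representations*, Princeton (1939), Ch. II §10. [Weyl1939]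
-/

set_option autoImplicit false
-- submodule-normed vs subtype topologies on `↥(skewC …)` (as in ★ U1 FILE B ∕ FILES 1–4)
set_option backward.isDefEq.respectTransparency false

noncomputable section

open Set Filter Topology MeasureTheory MeasureTheory.Measure NumberField NumberField.InfinitePlace Literature.Analysis.Calculus Literature.Analysis.Complex
open scoped Classical Matrix Matrix.Norms.Operator MatrixGroups ENNReal NNReal ComplexConjugate

namespace Literature.NumberTheory.Weil1964

namespace UnitaryArchLocalTopForm

open Literature.NumberTheory.Automorphic Literature.NumberTheory.Automorphic.UnitaryGroup

/-! ## §1 The twist `X ↦ Jw · X : 𝔲(Jw) ≃ 𝔲(1_N)` for a hermitian involution `Jw`, and the trace-form Lebesgue measures -/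

section Twist

variable {N : ℕ} {Jw : Matrix (Fin N) (Fin N) ℂ}

/-- For `Jw` hermitian: `Jw · X ∈ 𝔲(1_N) ⟺ X ∈ 𝔲(Jw)` (`(Jw X)ᴴ + Jw X = Xᴴ Jw + Jw X`). [cite: Weyl1939, Ch. II §10] -/
theorem form_mul_mem_skewC_one_iff (hJ : Jwᴴ = Jw) (X : Matrix (Fin N) (Fin N) ℂ) :
    Jw * X ∈ skewC N (1 : Matrix (Fin N) (Fin N) ℂ) ↔ X ∈ skewC N Jw := by
  rw [mem_skewC_iff, mem_skewC_iff, Matrix.conjTranspose_mul, hJ, Matrix.mul_one, Matrix.one_mul]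

/-- For `Jw` a hermitian involution: `Y ∈ 𝔲(1_N) ⇒ Jw · Y ∈ 𝔲(Jw)`. [cite: Weyl1939, Ch. II §10] -/
theorem form_mul_mem_skewC_of_mem_skewC_one (hJ : Jwᴴ = Jw) (hJ2 : Jw * Jw = 1) {Y : Matrix (Fin N) (Fin N) ℂ} (hY : Y ∈ skewC N (1 : Matrix (Fin N) (Fin N) ℂ)) :
    Jw * Y ∈ skewC N Jw := by
  rw [← form_mul_mem_skewC_one_iff hJ, ← Matrix.mul_assoc, hJ2, Matrix.one_mul]
  exact hY

/-- For `Jw` a hermitian involution, conjugation `X ↦ Jw X Jw` preserves `𝔲(Jw)`. [cite: Weyl1939, Ch. II §10] -/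
theorem form_mul_mul_form_mem_skewC (hJ : Jwᴴ = Jw) (hJ2 : Jw * Jw = 1) {X : Matrix (Fin N) (Fin N) ℂ} (hX : X ∈ skewC N Jw) : Jw * X * Jw ∈ skewC N Jw := by
  rw [mem_skewC_iff] at hX ⊢
  have hX' : Xᴴ * Jw = -(Jw * X) := eq_neg_of_add_eq_zero_left hX
  have h1 : Jw * Xᴴ = -(X * Jw) := by
    calc Jw * Xᴴ = Jw * Xᴴ * (Jw * Jw) := by rw [hJ2, Matrix.mul_one]
      _ = Jw * (Xᴴ * Jw) * Jw := by simp only [Matrix.mul_assoc]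
      _ = -(X * Jw) := by rw [hX', Matrix.mul_neg, Matrix.neg_mul, ← Matrix.mul_assoc, hJ2, Matrix.one_mul]
  rw [Matrix.conjTranspose_mul, Matrix.conjTranspose_mul, hJ]
  calc Jw * (Xᴴ * Jw) * Jw + Jw * (Jw * X * Jw) = Jw * Xᴴ * (Jw * Jw) + Jw * Jw * X * Jw := by simp only [Matrix.mul_assoc]
    _ = 0 := by rw [hJ2, Matrix.mul_one, Matrix.one_mul, h1, neg_add_cancel]

variable [MeasurableSpace (skewC N Jw)] [BorelSpace (skewC N Jw)] [MeasurableSpace (skewC N (1 : Matrix (Fin N) (Fin N) ℂ))] [BorelSpace (skewC N (1 : Matrix (Fin N) (Fin N) ℂ))]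

/-- **THE TWIST CARRIES `λ_{Jw}` TO `λ_{1}`**: for a hermitian involution `Jw` there is a continuous linear isomorphism `e : 𝔲(Jw) ≃ 𝔲(1_N)`, `e X = Jw · X`, with
`e_* lieStdLebesgueC N Jw = lieStdLebesgueC N 1` — the Gram matrix of the trace form on the mapped basis is `Θᵀ · Gram`, `Θ` the matrix of the involution `X ↦ Jw X Jw`
(`Re tr(Jw Xᵢ Jw Xⱼ) = β(Θ Xᵢ, Xⱼ)`), and `|det Θ| = 1`. [cite: Helgason2000, Ch. I §1 Thm. 1.14 p. 96] [cite: Weyl1939, Ch. II §10] -/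
theorem exists_formMul_equiv_map_lieStdLebesgueC (hJ : Jwᴴ = Jw) (hJ2 : Jw * Jw = 1) :
    ∃ e : skewC N Jw ≃L[ℝ] skewC N (1 : Matrix (Fin N) (Fin N) ℂ),
      (∀ X : skewC N Jw, ((e X : skewC N (1 : Matrix (Fin N) (Fin N) ℂ)) : Matrix (Fin N) (Fin N) ℂ) = Jw * (X : Matrix (Fin N) (Fin N) ℂ)) ∧
        (lieStdLebesgueC N Jw).map e = lieStdLebesgueC N (1 : Matrix (Fin N) (Fin N) ℂ) := by
  haveI : FiniteDimensional ℝ (Matrix (Fin N) (Fin N) ℂ) := finiteDimensional_matrixC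
  -- the twist as a linear isomorphism (inverse: the same multiplication)
  let eₗ : skewC N Jw ≃ₗ[ℝ] skewC N (1 : Matrix (Fin N) (Fin N) ℂ) :=
    { toFun := fun X => ⟨Jw * (X : Matrix (Fin N) (Fin N) ℂ), (form_mul_mem_skewC_one_iff hJ _).2 X.2⟩
      map_add' := fun X Y => Subtype.ext (by simp only [Submodule.coe_add, Matrix.mul_add])
      map_smul' := fun t X => Subtype.ext (by simp only [Submodule.coe_smul, RingHom.id_apply, Matrix.mul_smul])
      invFun := fun Y => ⟨Jw * (Y : Matrix (Fin N) (Fin N) ℂ), form_mul_mem_skewC_of_mem_skewC_one hJ hJ2 Y.2⟩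
      left_inv := fun X => Subtype.ext (by simp only [← Matrix.mul_assoc, hJ2, Matrix.one_mul])
      right_inv := fun Y => Subtype.ext (by simp only [← Matrix.mul_assoc, hJ2, Matrix.one_mul]) }
  let e : skewC N Jw ≃L[ℝ] skewC N (1 : Matrix (Fin N) (Fin N) ℂ) := eₗ.toContinuousLinearEquiv
  have he : ∀ X : skewC N Jw, ((e X : skewC N (1 : Matrix (Fin N) (Fin N) ℂ)) : Matrix (Fin N) (Fin N) ℂ) = Jw * (X : Matrix (Fin N) (Fin N) ℂ) := fun _ => rfl
  refine ⟨e, he, ?_⟩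
  -- the involution `Θ : X ↦ Jw X Jw` of `𝔲(Jw)`
  let Θ : skewC N Jw →ₗ[ℝ] skewC N Jw :=
    { toFun := fun X => ⟨Jw * (X : Matrix (Fin N) (Fin N) ℂ) * Jw, form_mul_mul_form_mem_skewC hJ hJ2 X.2⟩
      map_add' := fun X Y => Subtype.ext (by simp only [Submodule.coe_add, Matrix.mul_add, Matrix.add_mul])
      map_smul' := fun t X => Subtype.ext (by simp only [Submodule.coe_smul, RingHom.id_apply, Matrix.mul_smul, Matrix.smul_mul]) }
  have hΘ : ∀ X : skewC N Jw, ((Θ X : skewC N Jw) : Matrix (Fin N) (Fin N) ℂ) = Jw * (X : Matrix (Fin N) (Fin N) ℂ) * Jw := fun _ => rfl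
  have hΘΘ : Θ ∘ₗ Θ = LinearMap.id := by
    apply LinearMap.ext
    intro X
    apply Subtype.ext
    rw [LinearMap.comp_apply, hΘ, hΘ, LinearMap.id_apply]
    calc Jw * (Jw * (X : Matrix (Fin N) (Fin N) ℂ) * Jw) * Jw = Jw * Jw * (X : Matrix (Fin N) (Fin N) ℂ) * (Jw * Jw) := by simp only [Matrix.mul_assoc]
      _ = (X : Matrix (Fin N) (Fin N) ℂ) := by rw [hJ2, Matrix.one_mul, Matrix.mul_one]
  have hdetΘ : |LinearMap.det Θ| = 1 := by
    have h := congrArg LinearMap.det hΘΘ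
    rw [LinearMap.det_comp, LinearMap.det_id] at h
    rcases mul_self_eq_one_iff.1 h with h1 | h1 <;> simp [h1]
  -- the Gram relation on the basis of record
  set B := lieFinBasisC N Jw with hB
  have hgram : lieGramC (B.map eₗ) = (LinearMap.toMatrix B B Θ)ᵀ * lieGramC B := by
    ext i j
    have hexp : ((Θ (B i) : skewC N Jw) : Matrix (Fin N) (Fin N) ℂ) = ∑ k, LinearMap.toMatrix B B Θ k i • ((B k : skewC N Jw) : Matrix (Fin N) (Fin N) ℂ) := by
      conv_lhs => rw [← B.sum_repr (Θ (B i))]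
      rw [Submodule.coe_sum]
      exact Finset.sum_congr rfl fun k _ => by rw [LinearMap.toMatrix_apply, Submodule.coe_smul]
    have hlhs : lieGramC (B.map eₗ) i j = traceFormC N ((Θ (B i) : skewC N Jw) : Matrix (Fin N) (Fin N) ℂ) ((B j : skewC N Jw) : Matrix (Fin N) (Fin N) ℂ) := by
      rw [lieGramC_apply, Module.Basis.map_apply, Module.Basis.map_apply, traceFormC_apply, traceFormC_apply, hΘ]
      change (Matrix.trace (Jw * (B i : Matrix (Fin N) (Fin N) ℂ) * (Jw * (B j : Matrix (Fin N) (Fin N) ℂ)))).re = _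
      simp only [Matrix.mul_assoc]
    rw [hlhs, hexp, _root_.map_sum (traceFormC N), LinearMap.sum_apply, Matrix.mul_apply]
    refine Finset.sum_congr rfl fun k _ => ?_
    rw [LinearMap.map_smul, LinearMap.smul_apply, smul_eq_mul, Matrix.transpose_apply, lieGramC_apply]
  have hdet : |(lieGramC (B.map eₗ)).det| = |(lieGramC B).det| := by
    rw [hgram, Matrix.det_mul, Matrix.det_transpose, LinearMap.det_toMatrix, abs_mul, hdetΘ, one_mul]
  -- conclude with basis independence of `lieStdLebesgueC`
  -- (`lieStdLebesgueC_eq_smul_addHaar` carries the classical `DecidableEq` instance on the index type; `convert` aligns it with `Fin`'s)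
  have hlam1 : lieStdLebesgueC N (1 : Matrix (Fin N) (Fin N) ℂ) = ENNReal.ofReal (Real.sqrt |(lieGramC (B.map eₗ)).det|) • (B.map eₗ).addHaar := by
    convert lieStdLebesgueC_eq_smul_addHaar (N := N) (Jw := (1 : Matrix (Fin N) (Fin N) ℂ)) (B.map eₗ)
  have hBe : B.map e.toLinearEquiv = B.map eₗ := rfl
  rw [hlam1, hdet, lieStdLebesgueC_def, ← hB, Measure.map_smul, Module.Basis.map_addHaar B e, hBe]

end Twist

/-! ## §2 `N = 2`, `J₋ = diag(1, −1)`: the `(0,0)` entry of the Cayley transform and the pointwise identity `F(π(ĉ X)) · w₀^{J₋}(X) = w₀^{1}(J₋ X)` -/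

section RankTwo

/-- `J₋ = diag(1, −1)` is hermitian. [cite: Helgason2000, Introduction §4] -/
theorem conjTranspose_diagonal_one_neg_one : (Matrix.diagonal ![(1 : ℂ), -1])ᴴ = Matrix.diagonal ![(1 : ℂ), -1] := by
  rw [Matrix.diagonal_conjTranspose]
  congr 1
  funext i
  fin_cases i <;> simp

/-- `J₋² = 1`. [cite: Helgason2000, Introduction §4] -/
theorem diagonal_one_neg_one_mul_self : Matrix.diagonal ![(1 : ℂ), -1] * Matrix.diagonal ![(1 : ℂ), -1] = 1 := by
  rw [Matrix.diagonal_mul_diagonal, ← Matrix.diagonal_one]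
  congr 1
  funext i
  fin_cases i <;> simp

/-- `det J₋` is a unit. [cite: Helgason2000, Introduction §4] -/
theorem isUnit_det_diagonal_one_neg_one : IsUnit (Matrix.diagonal ![(1 : ℂ), -1]).det := by
  rw [Matrix.det_diagonal, isUnit_iff_ne_zero]
  exact Finset.prod_ne_zero_iff.2 fun i _ => by fin_cases i <;> simp

/-- **THE POLYNOMIAL IDENTITY** `((1 − X) · adj(1 + X))₀₀ = det(1 − J₋ X)` for every `X ∈ M₂(ℂ)`. [cite: Weyl1939, Ch. II §10] -/
theorem one_sub_mul_adjugate_one_add_apply_zero_zero (X : Matrix (Fin 2) (Fin 2) ℂ) :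
    ((1 - X) * (1 + X).adjugate) 0 0 = (1 - Matrix.diagonal ![(1 : ℂ), -1] * X).det := by
  rw [Matrix.adjugate_fin_two, Matrix.det_fin_two, Matrix.mul_apply, Fin.sum_univ_two]
  simp [Matrix.sub_apply, Matrix.add_apply, Matrix.mul_apply, Matrix.diagonal]

/-- On the chart source, `ĉ(X)₀₀ = det(1 − J₋ X) ∕ det(1 + X)`. [cite: Weyl1939, Ch. II §10] -/
theorem coe_cayleyChartC_apply_zero_zero {X : skewC 2 (Matrix.diagonal ![(1 : ℂ), -1])} (hX : X ∈ cayleySourceC 2 (Matrix.diagonal ![(1 : ℂ), -1])) :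
    (((cayleyChartC 2 (Matrix.diagonal ![(1 : ℂ), -1]) X : unitaryGroupOfForm (starRingEnd ℂ) (Matrix.diagonal ![(1 : ℂ), -1])) : GL (Fin 2) ℂ) : Matrix (Fin 2) (Fin 2) ℂ) 0 0 =
      ((1 + (X : Matrix (Fin 2) (Fin 2) ℂ)).det)⁻¹ * (1 - Matrix.diagonal ![(1 : ℂ), -1] * (X : Matrix (Fin 2) (Fin 2) ℂ)).det := by
  have hdet : IsUnit (1 + (X : Matrix (Fin 2) (Fin 2) ℂ)).det := (Matrix.isUnit_iff_isUnit_det _).1 hX.1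
  rw [coe_cayleyChartC hX, cayley_def, ← Matrix.nonsing_inv_eq_ringInverse, Matrix.inv_def, Matrix.mul_smul, Matrix.smul_apply, smul_eq_mul,
    one_sub_mul_adjugate_one_add_apply_zero_zero, Ring.inverse_eq_inv']

/-- On `U(1,1)`: `1 − |π h|² = |h₀₀|⁻²` (`π h = h₁₀ ∕ h₀₀`, `|h₀₀|² − |h₁₀|² = 1`). [cite: Helgason2000, Introduction §4] -/
theorem one_sub_norm_sq_chart (h : unitaryGroupOfForm (starRingEnd ℂ) (Matrix.diagonal ![(1 : ℂ), -1])) :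
    1 - ‖discMoebius ((h : GL (Fin 2) ℂ) : Matrix (Fin 2) (Fin 2) ℂ) 0‖ ^ 2 = (‖((h : GL (Fin 2) ℂ) : Matrix (Fin 2) (Fin 2) ℂ) 0 0‖ ^ 2)⁻¹ := by
  have h00 := apply_00_ne_zero h
  have hcol : ‖((h : GL (Fin 2) ℂ) : Matrix (Fin 2) (Fin 2) ℂ) 0 0‖ ^ 2 - ‖((h : GL (Fin 2) ℂ) : Matrix (Fin 2) (Fin 2) ℂ) 1 0‖ ^ 2 = 1 := by
    have e := conj_apply_mul_apply_00 (conjTranspose_mul_form_mul_eq h)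
    rw [← Complex.normSq_eq_conj_mul_self, ← Complex.normSq_eq_conj_mul_self, Complex.normSq_eq_norm_sq, Complex.normSq_eq_norm_sq] at e
    exact_mod_cast e
  have hpos : 0 < ‖((h : GL (Fin 2) ℂ) : Matrix (Fin 2) (Fin 2) ℂ) 0 0‖ ^ 2 := by positivity
  rw [chart_eq_div, norm_div, div_pow]
  field_simp
  linarith

/-- **THE POINTWISE IDENTITY**: for `X` in the chart source of `𝔲(J₋)` and `Y = J₋ · X ∈ 𝔲(2)`, `(1 − |π(ĉ X)|²)² · w₀^{J₋}(X) = w₀^{1}(Y)` — `|ĉ(X)₀₀| = |det(1 + Y)| ∕ |det(1 + X)|`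
(`det(1 − Y) = conj det(1 + Y)`, ★ `det_one_sub_eq_conj_det_one_add`) and `w₀ = |det(1 + ·)|⁻⁴` on both Lie algebras (★ `cayleyWeightC_eq`). [cite: Helgason2000, Ch. I §1 Thm. 1.14 p. 96] [cite: Weyl1939, Ch. II §10] -/
theorem sq_one_sub_norm_sq_chart_mul_cayleyWeightC_eq {X : skewC 2 (Matrix.diagonal ![(1 : ℂ), -1])} (hX : X ∈ cayleySourceC 2 (Matrix.diagonal ![(1 : ℂ), -1]))
    (Y : skewC 2 (1 : Matrix (Fin 2) (Fin 2) ℂ)) (hY : (Y : Matrix (Fin 2) (Fin 2) ℂ) = Matrix.diagonal ![(1 : ℂ), -1] * (X : Matrix (Fin 2) (Fin 2) ℂ)) :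
    (1 - ‖discMoebius (((cayleyChartC 2 (Matrix.diagonal ![(1 : ℂ), -1]) X : unitaryGroupOfForm (starRingEnd ℂ) (Matrix.diagonal ![(1 : ℂ), -1])) : GL (Fin 2) ℂ) :
        Matrix (Fin 2) (Fin 2) ℂ) 0‖ ^ 2) ^ 2 * cayleyWeightC 2 (Matrix.diagonal ![(1 : ℂ), -1]) X =
      cayleyWeightC 2 (1 : Matrix (Fin 2) (Fin 2) ℂ) Y := by
  have hdet0 : (1 + (X : Matrix (Fin 2) (Fin 2) ℂ)).det ≠ 0 := ((Matrix.isUnit_iff_isUnit_det _).1 hX.1).ne_zero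
  have hd : ‖(1 + (X : Matrix (Fin 2) (Fin 2) ℂ)).det‖ ≠ 0 := norm_ne_zero_iff.2 hdet0
  -- `|ĉ(X)₀₀| = |det(1 + Y)| / |det(1 + X)|`
  have h00 : ‖(((cayleyChartC 2 (Matrix.diagonal ![(1 : ℂ), -1]) X : unitaryGroupOfForm (starRingEnd ℂ) (Matrix.diagonal ![(1 : ℂ), -1])) : GL (Fin 2) ℂ) :
      Matrix (Fin 2) (Fin 2) ℂ) 0 0‖ = ‖(1 + (Y : Matrix (Fin 2) (Fin 2) ℂ)).det‖ / ‖(1 + (X : Matrix (Fin 2) (Fin 2) ℂ)).det‖ := by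
    rw [coe_cayleyChartC_apply_zero_zero hX, norm_mul, norm_inv, ← hY, det_one_sub_eq_conj_det_one_add (by simp) Y, Complex.norm_conj, mul_comm, div_eq_mul_inv]
  rw [one_sub_norm_sq_chart, h00, cayleyWeightC_eq conjTranspose_diagonal_one_neg_one isUnit_det_diagonal_one_neg_one X,
    cayleyWeightC_eq Matrix.conjTranspose_one (by simp) Y]
  field_simp

end RankTwo

/-! ## §3 The disc constant: `C · π = ∫_{𝔲(2)} w₀ dλ` -/

section DiscConstant

variable [MeasurableSpace (GL (Fin 2) ℂ)] [BorelSpace (GL (Fin 2) ℂ)]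
  [MeasurableSpace (skewC 2 (Matrix.diagonal ![(1 : ℂ), -1]))] [BorelSpace (skewC 2 (Matrix.diagonal ![(1 : ℂ), -1]))]
  [MeasurableSpace (skewC 2 (1 : Matrix (Fin 2) (Fin 2) ℂ))] [BorelSpace (skewC 2 (1 : Matrix (Fin 2) (Fin 2) ℂ))]

omit [MeasurableSpace (skewC 2 (Matrix.diagonal ![(1 : ℂ), -1]))] [BorelSpace (skewC 2 (Matrix.diagonal ![(1 : ℂ), -1]))]
  [MeasurableSpace (skewC 2 (1 : Matrix (Fin 2) (Fin 2) ℂ))] [BorelSpace (skewC 2 (1 : Matrix (Fin 2) (Fin 2) ℂ))] in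
/-- The test function `h ↦ (1 − |π h|²)²` is measurable on `U(1,1)`. [cite: Helgason2000, Introduction §4] -/
theorem measurable_sq_one_sub_norm_sq_chart :
    Measurable fun h : unitaryGroupOfForm (starRingEnd ℂ) (Matrix.diagonal ![(1 : ℂ), -1]) => ENNReal.ofReal ((1 - ‖discMoebius ((h : GL (Fin 2) ℂ) : Matrix (Fin 2) (Fin 2) ℂ) 0‖ ^ 2) ^ 2) :=
  ((continuous_const.sub (continuous_chart.norm.pow 2)).pow 2).measurable.ennreal_ofReal

omit [MeasurableSpace (GL (Fin 2) ℂ)] [BorelSpace (GL (Fin 2) ℂ)] [MeasurableSpace (skewC 2 (Matrix.diagonal ![(1 : ℂ), -1]))] [BorelSpace (skewC 2 (Matrix.diagonal ![(1 : ℂ), -1]))]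
  [MeasurableSpace (skewC 2 (1 : Matrix (Fin 2) (Fin 2) ℂ))] [BorelSpace (skewC 2 (1 : Matrix (Fin 2) (Fin 2) ℂ))] in
/-- **`∫_𝔻 (1 − |w|²)² dμ_hyp = π`** (`μ_hyp = (1 − |w|²)⁻² dA` on the disc, whose area is `π`). [cite: Helgason2000, Introduction §4] -/
theorem lintegral_sq_one_sub_norm_sq_discHyperbolicMeasure :
    ∫⁻ w, ENNReal.ofReal ((1 - ‖w‖ ^ 2) ^ 2) ∂discHyperbolicMeasure = NNReal.pi := by
  rw [discHyperbolicMeasure, lintegral_withDensity_eq_lintegral_mul _ (by fun_prop) (by fun_prop)]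
  have h1 : EqOn ((fun w : ℂ => ENNReal.ofReal (((1 - ‖w‖ ^ 2)⁻¹) ^ 2)) * fun w : ℂ => ENNReal.ofReal ((1 - ‖w‖ ^ 2) ^ 2)) (fun _ => (1 : ℝ≥0∞))
      (Metric.ball (0 : ℂ) 1) := by
    intro w hw
    have hw1 : ‖w‖ < 1 := by simpa using hw
    have hlt : ‖w‖ ^ 2 < 1 := by nlinarith [norm_nonneg w]
    have hpos : 0 < 1 - ‖w‖ ^ 2 := by linarith
    rw [Pi.mul_apply, ← ENNReal.ofReal_mul (sq_nonneg _), inv_pow, inv_mul_cancel₀ (pow_ne_zero 2 hpos.ne'), ENNReal.ofReal_one]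
  rw [setLIntegral_congr_fun Metric.isOpen_ball.measurableSet h1, setLIntegral_const, one_mul, Complex.volume_ball, ENNReal.ofReal_one, one_pow, one_mul]

omit [MeasurableSpace (skewC 2 (Matrix.diagonal ![(1 : ℂ), -1]))] [BorelSpace (skewC 2 (Matrix.diagonal ![(1 : ℂ), -1]))]
  [MeasurableSpace (skewC 2 (1 : Matrix (Fin 2) (Fin 2) ℂ))] [BorelSpace (skewC 2 (1 : Matrix (Fin 2) (Fin 2) ℂ))] in
/-- **THE DISC SIDE**: if `μ.map π = C • μ_hyp` then `∫_{U(1,1)} (1 − |π h|²)² dμ(h) = C · π`. [cite: Helgason2000, Introduction §4] -/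
theorem lintegral_sq_one_sub_norm_sq_chart_eq_mul_pi (μ : Measure (unitaryGroupOfForm (starRingEnd ℂ) (Matrix.diagonal ![(1 : ℂ), -1]))) {C : ℝ≥0}
    (hC : μ.map (fun h : unitaryGroupOfForm (starRingEnd ℂ) (Matrix.diagonal ![(1 : ℂ), -1]) => discMoebius ((h : GL (Fin 2) ℂ) : Matrix (Fin 2) (Fin 2) ℂ) 0) = C • discHyperbolicMeasure) :
    ∫⁻ h, ENNReal.ofReal ((1 - ‖discMoebius ((h : GL (Fin 2) ℂ) : Matrix (Fin 2) (Fin 2) ℂ) 0‖ ^ 2) ^ 2) ∂μ = (C : ℝ≥0∞) * NNReal.pi := by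
  have hF : Measurable fun w : ℂ => ENNReal.ofReal ((1 - ‖w‖ ^ 2) ^ 2) := by fun_prop
  rw [← lintegral_map hF continuous_chart.measurable, hC, lintegral_smul_measure, lintegral_sq_one_sub_norm_sq_discHyperbolicMeasure, ENNReal.smul_def, smul_eq_mul]

/-- **THE GROUP SIDE, for any measure read in the Cayley chart** (`hμ`, ★ FILE 4's shape): `∫_{U(1,1)} (1 − |π h|²)² dμ = ∫⁻_{𝔲(2)} w₀ dλ` — the pointwise identity of §2
on the source, `λ(sourceᶜ) = 0` (★ FILE 1), and the twist of §1. [cite: Helgason2000, Ch. I §1 Thm. 1.14 p. 96] [cite: Weyl1939, Ch. II §10] -/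
theorem lintegral_sq_one_sub_norm_sq_chart_eq_lintegral_cayleyWeightC_one (μ : Measure (unitaryGroupOfForm (starRingEnd ℂ) (Matrix.diagonal ![(1 : ℂ), -1])))
    (hμ : ∀ g : unitaryGroupOfForm (starRingEnd ℂ) (Matrix.diagonal ![(1 : ℂ), -1]) → ℝ≥0∞, Measurable g →
      ∫⁻ h, g h ∂μ = ∫⁻ X in cayleySourceC 2 (Matrix.diagonal ![(1 : ℂ), -1]), g (cayleyChartC 2 (Matrix.diagonal ![(1 : ℂ), -1]) X) *
        ENNReal.ofReal (cayleyWeightC 2 (Matrix.diagonal ![(1 : ℂ), -1]) X) ∂lieStdLebesgueC 2 (Matrix.diagonal ![(1 : ℂ), -1])) :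
    ∫⁻ h, ENNReal.ofReal ((1 - ‖discMoebius ((h : GL (Fin 2) ℂ) : Matrix (Fin 2) (Fin 2) ℂ) 0‖ ^ 2) ^ 2) ∂μ =
      ∫⁻ Y, ENNReal.ofReal (cayleyWeightC 2 (1 : Matrix (Fin 2) (Fin 2) ℂ) Y) ∂lieStdLebesgueC 2 (1 : Matrix (Fin 2) (Fin 2) ℂ) := by
  haveI := isAddHaarMeasure_lieStdLebesgueC (N := 2) (Jw := Matrix.diagonal ![(1 : ℂ), -1])
    (lieGramDetC_ne_zero_of_conjTranspose_eq conjTranspose_diagonal_one_neg_one isUnit_det_diagonal_one_neg_one)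
  obtain ⟨e, he, hmap⟩ := exists_formMul_equiv_map_lieStdLebesgueC (N := 2) conjTranspose_diagonal_one_neg_one diagonal_one_neg_one_mul_self
  rw [hμ _ measurable_sq_one_sub_norm_sq_chart]
  -- pointwise on the source
  have hpt : EqOn (fun X : skewC 2 (Matrix.diagonal ![(1 : ℂ), -1]) =>
        ENNReal.ofReal ((1 - ‖discMoebius (((cayleyChartC 2 (Matrix.diagonal ![(1 : ℂ), -1]) X : unitaryGroupOfForm (starRingEnd ℂ) (Matrix.diagonal ![(1 : ℂ), -1])) :
          GL (Fin 2) ℂ) : Matrix (Fin 2) (Fin 2) ℂ) 0‖ ^ 2) ^ 2) * ENNReal.ofReal (cayleyWeightC 2 (Matrix.diagonal ![(1 : ℂ), -1]) X))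
      (fun X => ENNReal.ofReal (cayleyWeightC 2 (1 : Matrix (Fin 2) (Fin 2) ℂ) (e X))) (cayleySourceC 2 (Matrix.diagonal ![(1 : ℂ), -1])) := by
    intro X hX
    simp only []
    rw [← ENNReal.ofReal_mul (sq_nonneg _), sq_one_sub_norm_sq_chart_mul_cayleyWeightC_eq hX (e X) (he X)]
  rw [setLIntegral_congr_fun isOpen_cayleySourceC.measurableSet hpt, setLIntegral_cayleySourceC_eq, ← hmap,
    lintegral_map (measurable_cayleyWeightC.ennreal_ofReal) e.continuous.measurable]

/-- **THE DISC CONSTANT, abstract form**: a measure `μ` on `U(1,1)` read in the Cayley chart (`hμ`) with `μ.map π = C • μ_hyp` has `C · π = ∫⁻_{𝔲(2)} w₀ dλ`.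
[cite: Helgason2000, Introduction §4; Ch. I §1 Thm. 1.14 p. 96] [cite: Rogawski1990, §8.2 p. 118] -/
theorem smul_pi_eq_lintegral_cayleyWeightC_one_of (μ : Measure (unitaryGroupOfForm (starRingEnd ℂ) (Matrix.diagonal ![(1 : ℂ), -1])))
    (hμ : ∀ g : unitaryGroupOfForm (starRingEnd ℂ) (Matrix.diagonal ![(1 : ℂ), -1]) → ℝ≥0∞, Measurable g →
      ∫⁻ h, g h ∂μ = ∫⁻ X in cayleySourceC 2 (Matrix.diagonal ![(1 : ℂ), -1]), g (cayleyChartC 2 (Matrix.diagonal ![(1 : ℂ), -1]) X) *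
        ENNReal.ofReal (cayleyWeightC 2 (Matrix.diagonal ![(1 : ℂ), -1]) X) ∂lieStdLebesgueC 2 (Matrix.diagonal ![(1 : ℂ), -1]))
    {C : ℝ≥0} (hC : μ.map (fun h : unitaryGroupOfForm (starRingEnd ℂ) (Matrix.diagonal ![(1 : ℂ), -1]) => discMoebius ((h : GL (Fin 2) ℂ) : Matrix (Fin 2) (Fin 2) ℂ) 0) = C • discHyperbolicMeasure) :
    (C : ℝ≥0∞) * NNReal.pi = ∫⁻ Y, ENNReal.ofReal (cayleyWeightC 2 (1 : Matrix (Fin 2) (Fin 2) ℂ) Y) ∂lieStdLebesgueC 2 (1 : Matrix (Fin 2) (Fin 2) ℂ) := by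
  rw [← lintegral_sq_one_sub_norm_sq_chart_eq_mul_pi μ hC, lintegral_sq_one_sub_norm_sq_chart_eq_lintegral_cayleyWeightC_one μ hμ]

end DiscConstant

/-! ## §4 The top-form measure of `U(1,1)`: `π · C_disc(μ^TF_{J₋}) = ∫_{𝔲(2)} w₀ dλ = V₂` -/

section TopForm

variable (L : Type) [Field L] [NumberField L] [IsCMField L]

omit [NumberField L] [IsCMField L] in
/-- At every complex place of a CM field, `σ_w diag(1, −1) = diag(1, −1)` over `ℂ`. [cite: Helgason2000, Introduction §4] -/
theorem map_embedding_diagonal_one_neg_one (w : {w : InfinitePlace L // IsComplex w}) :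
    (Matrix.diagonal ![(1 : L), -1]).map w.1.embedding = Matrix.diagonal ![(1 : ℂ), -1] := by
  rw [Matrix.diagonal_map (map_zero _)]
  congr 1
  funext i
  fin_cases i <;> simp

variable [MeasurableSpace (GL (Fin 2) ℂ)] [BorelSpace (GL (Fin 2) ℂ)]
  [MeasurableSpace (skewC 2 (Matrix.diagonal ![(1 : ℂ), -1]))] [BorelSpace (skewC 2 (Matrix.diagonal ![(1 : ℂ), -1]))]
  [MeasurableSpace (skewC 2 (1 : Matrix (Fin 2) (Fin 2) ℂ))] [BorelSpace (skewC 2 (1 : Matrix (Fin 2) (Fin 2) ℂ))]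

omit [MeasurableSpace (skewC 2 (1 : Matrix (Fin 2) (Fin 2) ℂ))] [BorelSpace (skewC 2 (1 : Matrix (Fin 2) (Fin 2) ℂ))] in
/-- **`μ^TF` on `U(1,1)` read in the Cayley chart** (★ FILE 4 at a complex place of the CM field `L`, where `σ_w diag(1,−1) = diag(1,−1)`).
[cite: Helgason2000, Ch. I §1 Thm. 1.14 p. 96] [cite: Rogawski1990, §1.7 p. 6] -/
theorem lintegral_localTopFormHaar_diagonal_one_neg_one_eq (w : {w : InfinitePlace L // IsComplex w})
    {g : unitaryGroupOfForm (starRingEnd ℂ) (Matrix.diagonal ![(1 : ℂ), -1]) → ℝ≥0∞} (hg : Measurable g) :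
    ∫⁻ h, g h ∂localTopFormHaar 2 (Matrix.diagonal ![(1 : ℂ), -1]) =
      ∫⁻ X in cayleySourceC 2 (Matrix.diagonal ![(1 : ℂ), -1]), g (cayleyChartC 2 (Matrix.diagonal ![(1 : ℂ), -1]) X) *
        ENNReal.ofReal (cayleyWeightC 2 (Matrix.diagonal ![(1 : ℂ), -1]) X) ∂lieStdLebesgueC 2 (Matrix.diagonal ![(1 : ℂ), -1]) := by
  -- transport ★ FILE 4 along `σ_w diag(1,−1) = diag(1,−1)` (generalise the carrier, then substitute)
  have key : ∀ (Jw : Matrix (Fin 2) (Fin 2) ℂ), Jw = (Matrix.diagonal ![(1 : L), -1]).map w.1.embedding →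
      ∀ [MeasurableSpace (skewC 2 Jw)] [BorelSpace (skewC 2 Jw)] (g : unitaryGroupOfForm (starRingEnd ℂ) Jw → ℝ≥0∞), Measurable g →
        ∫⁻ h, g h ∂localTopFormHaar 2 Jw = ∫⁻ X in cayleySourceC 2 Jw, g (cayleyChartC 2 Jw X) * ENNReal.ofReal (cayleyWeightC 2 Jw X) ∂lieStdLebesgueC 2 Jw := by
    rintro Jw rfl _ _ g hg
    have hherm : ((Matrix.diagonal ![(1 : L), -1]).map (IsCMField.complexConj L))ᵀ = Matrix.diagonal ![(1 : L), -1] := by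
      rw [Matrix.diagonal_map (map_zero _), Matrix.diagonal_transpose]
      congr 1; funext i; fin_cases i <;> simp
    have hdet : IsUnit (Matrix.diagonal ![(1 : L), -1]).det := by
      rw [Matrix.det_diagonal, isUnit_iff_ne_zero]
      exact Finset.prod_ne_zero_iff.2 fun i _ => by fin_cases i <;> simp
    exact lintegral_archLocalTopFormHaar_eq_setLIntegral L 2 (Matrix.diagonal ![(1 : L), -1]) hherm hdet w hg
  exact key _ (map_embedding_diagonal_one_neg_one L w).symm g hg

/-- **THE TOP-FORM DISC CONSTANT**: for every `C` with `(localTopFormHaar 2 diag(1,−1)).map π = C • μ_hyp` (★ HAT-BOX `exists_map_chart_eq_smul_discHyperbolicMeasure` gives one),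
`C · π = ∫⁻_{𝔲(2)} w₀ dλ` — the top-form mass of `U(2)` read on its Lie algebra (★ `archLocalTopFormHaar_univ_eq_lintegral`).  (A complex place `w` of a CM field `L`
parametrises the proof only.) [cite: Helgason2000, Introduction §4; Ch. I §1 Thm. 1.14 p. 96] [cite: Rogawski1990, §1.7 p. 6; §8.2 p. 118] -/
theorem topFormDiscConstant_mul_pi_eq_lintegral (w : {w : InfinitePlace L // IsComplex w}) {C : ℝ≥0}
    (hC : (localTopFormHaar 2 (Matrix.diagonal ![(1 : ℂ), -1])).map
        (fun h : unitaryGroupOfForm (starRingEnd ℂ) (Matrix.diagonal ![(1 : ℂ), -1]) => discMoebius ((h : GL (Fin 2) ℂ) : Matrix (Fin 2) (Fin 2) ℂ) 0) = C • discHyperbolicMeasure) :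
    (C : ℝ≥0∞) * NNReal.pi = ∫⁻ Y, ENNReal.ofReal (cayleyWeightC 2 (1 : Matrix (Fin 2) (Fin 2) ℂ) Y) ∂lieStdLebesgueC 2 (1 : Matrix (Fin 2) (Fin 2) ℂ) :=
  smul_pi_eq_lintegral_cayleyWeightC_one_of _ (fun _ hg => lintegral_localTopFormHaar_diagonal_one_neg_one_eq L w hg) hC

/-- The same with the `𝔲(2)`-integral over the chart source (`λ(sourceᶜ) = 0`, ★ FILE 1). [cite: Helgason2000, Ch. I §1 Thm. 1.14 p. 96] -/
theorem topFormDiscConstant_mul_pi_eq_setLIntegral (w : {w : InfinitePlace L // IsComplex w}) {C : ℝ≥0}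
    (hC : (localTopFormHaar 2 (Matrix.diagonal ![(1 : ℂ), -1])).map
        (fun h : unitaryGroupOfForm (starRingEnd ℂ) (Matrix.diagonal ![(1 : ℂ), -1]) => discMoebius ((h : GL (Fin 2) ℂ) : Matrix (Fin 2) (Fin 2) ℂ) 0) = C • discHyperbolicMeasure) :
    (C : ℝ≥0∞) * NNReal.pi =
      ∫⁻ Y in cayleySourceC 2 (1 : Matrix (Fin 2) (Fin 2) ℂ), ENNReal.ofReal (cayleyWeightC 2 (1 : Matrix (Fin 2) (Fin 2) ℂ) Y) ∂lieStdLebesgueC 2 (1 : Matrix (Fin 2) (Fin 2) ℂ) := by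
  haveI := isAddHaarMeasure_lieStdLebesgueC (N := 2) (Jw := (1 : Matrix (Fin 2) (Fin 2) ℂ)) (lieGramDetC_ne_zero_of_conjTranspose_eq Matrix.conjTranspose_one (by simp))
  rw [setLIntegral_cayleySourceC_eq, topFormDiscConstant_mul_pi_eq_lintegral L w hC]

/-- **EXISTENCE PACKAGE**: there is `C ≠ 0` with `(μ^TF_{J₋}).map π = C • μ_hyp` AND `C · π = ∫⁻_{𝔲(2)} w₀ dλ` (★ HAT-BOX + the above; `μ^TF_{J₋}` is Haar by ★ U1′).
[cite: Helgason2000, Introduction §4] [cite: Rogawski1990, §8.2 p. 118] -/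
theorem exists_topFormDiscConstant (w : {w : InfinitePlace L // IsComplex w}) :
    ∃ C : ℝ≥0, C ≠ 0 ∧
      (localTopFormHaar 2 (Matrix.diagonal ![(1 : ℂ), -1])).map
          (fun h : unitaryGroupOfForm (starRingEnd ℂ) (Matrix.diagonal ![(1 : ℂ), -1]) => discMoebius ((h : GL (Fin 2) ℂ) : Matrix (Fin 2) (Fin 2) ℂ) 0) = C • discHyperbolicMeasure ∧
        (C : ℝ≥0∞) * NNReal.pi = ∫⁻ Y, ENNReal.ofReal (cayleyWeightC 2 (1 : Matrix (Fin 2) (Fin 2) ℂ) Y) ∂lieStdLebesgueC 2 (1 : Matrix (Fin 2) (Fin 2) ℂ) := by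
  haveI := isHaarMeasure_localTopFormHaar_of_conjTranspose_eq (N := 2) conjTranspose_diagonal_one_neg_one isUnit_det_diagonal_one_neg_one
  obtain ⟨C, hC0, hC⟩ := exists_map_chart_eq_smul_discHyperbolicMeasure (localTopFormHaar 2 (Matrix.diagonal ![(1 : ℂ), -1]))
  exact ⟨C, hC0, hC, topFormDiscConstant_mul_pi_eq_lintegral L w hC⟩

end TopForm

end UnitaryArchLocalTopForm

end Literature.NumberTheory.Weil1964

end
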